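/-
Copyright (c) 2026. All rights reserved.
Released under Apache 2.0 license as described in the file LICENSE.
Authors: HodgeCM publication cell (pub-hodgecm), DAG-node prover lineage #14 (gen 6: statements and proofs;
gen 7: tree port).
-/
import Mathlib.Analysis.Distribution.SchwartzSpace.Basic
import Literature.Analysis.Calculus.DerivativeInterpolation
import HarnessLib

/-!
# On Schwartz-bounded sets, uniform convergence is Schwartz convergence

Topic `Analysis/Distribution`; namespace `Literature.Analysis.Distribution`.  The engine behind every
"Fréchet-smooth vector" statement for one-parameter groups acting on the Schwartz space `𝓢(E, F)` (the files
`SchwartzLinearFlowEstimates`, `SchwartzLinearFlowDeriv`, `SchwartzTranslationFlowDeriv`, … of this directory):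
to prove that a net `f i → g` in the **Schwartz topology** of `𝓢(E, F)` it suffices to prove

* (boundedness) every Schwartz seminorm `p_{k,n}(f i)` is eventually bounded, and
* (uniform convergence) `f i → g` uniformly on `E` (i.e. in the single seminorm `p₀,₀`).

Abstractly this is the fact that `𝓢` is a Montel space, so that on bounded sets its topology agrees with any
weaker Hausdorff locally convex topology (F. Trèves, *Topological Vector Spaces, Distributions and Kernels*
(1967), Ch. 34 and Ch. 51 [Treves1967]; M. Reed, B. Simon, *Methods of Modern Mathematical Physics I*, §V.3
[ReedSimonI1980]).  The proof here is elementary and quantitative, with no compactness: **Landau's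
interpolation inequality** between the orders `n`, `n + 1`, `n + 2` — the tree's
`Literature.Analysis.Calculus.norm_iteratedFDeriv_succ_le_of_bounds` (Landau 1913; Dieudonné (8.6);
Hörmander, *ALPDO I* [HormanderALPDO1], proof of Thm. 1.1.7 ff.) — upgrades uniform smallness of `Dⁿ(f i)` to
uniform smallness of `Dⁿ⁺¹(f i)` given a bound on `Dⁿ⁺²(f i)` (`eventually_norm_iteratedFDeriv_le`), and the
weight `‖x‖^k` is traded against one more power of decay (`tendsto_zero_of_seminorm_bounded_of_uniform`).

## Main statements

* `eventually_norm_iteratedFDeriv_le` — Step A: bounded in `𝓢` + uniformly small ⇒ every derivative uniformly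
  small;
* `tendsto_zero_of_seminorm_bounded_of_uniform`, `tendsto_of_seminorm_bounded_of_uniform` — the criterion
  (null-net form and general form);
* `tendsto_of_seminorm_bounded_of_tendsto_seminorm_zero` — the same with uniform convergence phrased through
  the seminorm `p₀,₀`.

Design: plain `Filter.Tendsto` statements over an arbitrary filter, hypotheses as `∀ k n, ∃ C, ∀ᶠ i, …`, so that
the criterion applies verbatim to difference quotients `s⁻¹ • (Φ ∘ L s - Φ)` along `𝓝[≠] 0`.  NOT here: the
Montel property itself, bounded sets of `𝓢` as a bornology, sequential versions.

Provenance: tree port (LEAN-IN-TREE, 2026-08-18) of the HodgeCM publication cell's package file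
`HodgeCM/Automorphic/SchwartzBoundedConvergence.lean` (unit `pub-hodgecm-pv14-g6`, gate run 30; namespace
`HodgeCM.SchwartzWeil` ↦ `Literature.Analysis.Distribution`, statements verbatim), with the package's private
copy of Landau's inequality replaced by the tree's `DerivativeInterpolation` file.  Nothing in this file is
specific to that cell or under adjudication there.
-/

set_option autoImplicit false

noncomputable section

open scoped SchwartzMap Topology ContDiff
open Filter Set Metric

namespace Literature.Analysis.Distribution

variable {E F : Type*} [NormedAddCommGroup E] [NormedSpace ℝ E] [NormedAddCommGroup F] [NormedSpace ℝ F]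

/-! ## From uniform smallness of `Dⁿ f` to uniform smallness of `Dⁿ⁺¹ f` -/

/-- **Step A.**  If all `p₀,ₘ (f i)` are eventually bounded along `l` and `f i → 0` uniformly on `E`, then every
derivative `Dⁿ (f i) → 0` uniformly on `E`.  Induction on `n`; the step is Landau's inequality
`‖Dⁿ⁺¹ g‖ ≤ 2 M₀ / s + s M₂` (`Calculus.norm_iteratedFDeriv_succ_le_of_bounds`) with `M₀ = ε s / 4`,
`s = ε / (2 M₂)`. [folklore] -/
theorem eventually_norm_iteratedFDeriv_le {ι : Type*} {l : Filter ι} {f : ι → 𝓢(E, F)}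
    (hb : ∀ n : ℕ, ∃ C, ∀ᶠ i in l, SchwartzMap.seminorm ℝ 0 n (f i) ≤ C)
    (h0 : ∀ ε, 0 < ε → ∀ᶠ i in l, ∀ x, ‖f i x‖ ≤ ε) (n : ℕ) :
    ∀ ε, 0 < ε → ∀ᶠ i in l, ∀ x, ‖iteratedFDeriv ℝ n (f i) x‖ ≤ ε := by
  induction n with
  | zero =>
    intro ε hε
    filter_upwards [h0 ε hε] with i hi x
    rw [norm_iteratedFDeriv_zero]
    exact hi x
  | succ n ih =>
    intro ε hε
    obtain ⟨C, hC⟩ := hb (n + 2)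
    set C' : ℝ := max C 1 with hC'
    have hC'pos : 0 < C' := lt_of_lt_of_le one_pos (le_max_right _ _)
    set s : ℝ := ε / (2 * C') with hs
    have hspos : 0 < s := by positivity
    filter_upwards [hC, ih (ε * s / 4) (by positivity)] with i hiC hiε x
    have hC2 : ∀ z, ‖iteratedFDeriv ℝ (n + 2) (f i) z‖ ≤ C' := fun z =>
      ((SchwartzMap.norm_iteratedFDeriv_le_seminorm ℝ (f i) (n + 2) z).trans hiC).trans (le_max_left _ _)
    have hsmooth : ContDiff ℝ ∞ (f i : E → F) := (f i).smooth ⊤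
    have key := Calculus.norm_iteratedFDeriv_succ_le_of_bounds hsmooth (p := x) (r := s + 1) hC'pos.le
      (k := n) (fun y _ => hiε y) (fun y _ => hC2 y) hspos (by linarith)
    refine key.trans (le_of_eq ?_)
    rw [hs]; field_simp; ring

/-! ## The convergence criterion -/

/-- **On Schwartz-bounded sets, uniform convergence is Schwartz convergence** (null-net form): if every Schwartz
seminorm of `f i` is eventually bounded and `f i → 0` uniformly on `E`, then `f i → 0` in `𝓢(E, F)`.
For `p_{k,n}`: on `‖x‖ ≤ R` use Step A for `Dⁿ`; on `‖x‖ > R` use `‖x‖^{k+1} ‖Dⁿ(f i) x‖ ≤ M`, i.e. trade the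
weight against one more power of decay, with `R = max (2M/ε) 1`. [folklore] -/
theorem tendsto_zero_of_seminorm_bounded_of_uniform {ι : Type*} {l : Filter ι} {f : ι → 𝓢(E, F)}
    (hb : ∀ k n : ℕ, ∃ C, ∀ᶠ i in l, SchwartzMap.seminorm ℝ k n (f i) ≤ C)
    (h0 : ∀ ε, 0 < ε → ∀ᶠ i in l, ∀ x, ‖f i x‖ ≤ ε) : Tendsto f l (𝓝 0) := by
  rw [(schwartz_withSeminorms ℝ E F).tendsto_nhds]
  rintro ⟨k, n⟩ ε hε
  obtain ⟨C, hC⟩ := hb (k + 1) n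
  set M : ℝ := max C 0 with hM
  have hM0 : 0 ≤ M := le_max_right _ _
  set R : ℝ := max (2 * M / ε) 1 with hR
  have hRpos : 0 < R := lt_of_lt_of_le one_pos (le_max_right _ _)
  have hA := eventually_norm_iteratedFDeriv_le (fun m => hb 0 m) h0 n (ε / (4 * R ^ k)) (by positivity)
  filter_upwards [hC, hA] with i hiC hiA
  simp only [SchwartzMap.schwartzSeminormFamily_apply, sub_zero]
  refine lt_of_le_of_lt (SchwartzMap.seminorm_le_bound ℝ k n (f i) (by positivity : (0 : ℝ) ≤ ε / 2)
    fun x => ?_) (by linarith)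
  rcases le_or_gt ‖x‖ R with hx | hx
  · calc ‖x‖ ^ k * ‖iteratedFDeriv ℝ n (f i) x‖ ≤ R ^ k * (ε / (4 * R ^ k)) :=
          mul_le_mul (pow_le_pow_left₀ (norm_nonneg _) hx k) (hiA x) (norm_nonneg _) (by positivity)
      _ = ε / 4 := by field_simp
      _ ≤ ε / 2 := by linarith
  · have hxpos : 0 < ‖x‖ := hRpos.trans hx
    have h1 : ‖x‖ ^ (k + 1) * ‖iteratedFDeriv ℝ n (f i) x‖ ≤ M :=
      ((SchwartzMap.le_seminorm ℝ (k + 1) n (f i) x).trans hiC).trans (le_max_left _ _)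
    have h2 : 2 * M ≤ R * ε := by
      have : 2 * M / ε ≤ R := le_max_left _ _
      rwa [div_le_iff₀ hε] at this
    calc ‖x‖ ^ k * ‖iteratedFDeriv ℝ n (f i) x‖
        = ‖x‖ ^ (k + 1) * ‖iteratedFDeriv ℝ n (f i) x‖ / ‖x‖ := by
          rw [pow_succ]; field_simp
      _ ≤ M / R := div_le_div₀ hM0 h1 hRpos hx.le
      _ ≤ ε / 2 := by
          rw [div_le_iff₀ hRpos]
          linarith

/-- **On Schwartz-bounded sets, uniform convergence is Schwartz convergence.**  If every Schwartz seminorm of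
`f i` is eventually bounded and `f i → g` uniformly on `E`, then `f i → g` in the Schwartz topology (apply the
null-net form to `f i - g`). [folklore] -/
theorem tendsto_of_seminorm_bounded_of_uniform {ι : Type*} {l : Filter ι} {f : ι → 𝓢(E, F)} {g : 𝓢(E, F)}
    (hb : ∀ k n : ℕ, ∃ C, ∀ᶠ i in l, SchwartzMap.seminorm ℝ k n (f i) ≤ C)
    (h0 : ∀ ε, 0 < ε → ∀ᶠ i in l, ∀ x, ‖f i x - g x‖ ≤ ε) : Tendsto f l (𝓝 g) := by
  rw [← tendsto_sub_nhds_zero_iff]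
  refine tendsto_zero_of_seminorm_bounded_of_uniform (fun k n => ?_) (by simpa only [sub_apply] using h0)
  obtain ⟨C, hC⟩ := hb k n
  refine ⟨C + SchwartzMap.seminorm ℝ k n g, ?_⟩
  filter_upwards [hC] with i hi
  exact (map_sub_le_add _ _ _).trans (by linarith)

/-- The same criterion with the uniform convergence phrased through the seminorm `p₀,₀`:
bounded in `𝓢` and `p₀,₀(f i - g) → 0` imply `f i → g` in `𝓢(E, F)`. [folklore] -/
theorem tendsto_of_seminorm_bounded_of_tendsto_seminorm_zero {ι : Type*} {l : Filter ι} {f : ι → 𝓢(E, F)}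
    {g : 𝓢(E, F)} (hb : ∀ k n : ℕ, ∃ C, ∀ᶠ i in l, SchwartzMap.seminorm ℝ k n (f i) ≤ C)
    (h0 : Tendsto (fun i => SchwartzMap.seminorm ℝ 0 0 (f i - g)) l (𝓝 0)) : Tendsto f l (𝓝 g) := by
  refine tendsto_of_seminorm_bounded_of_uniform hb fun ε hε => ?_
  filter_upwards [(tendsto_order.1 h0).2 ε hε] with i hi x
  exact ((SchwartzMap.norm_le_seminorm ℝ (f i - g) x).trans hi.le)

end Literature.Analysis.Distribution
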